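import Summits.BirchSwinnertonDyer.BirchSwinnertonDyer.Theorems.Rank2Observatory2DescClSplitImageNodal
import Summits.BirchSwinnertonDyer.BirchSwinnertonDyer.Theorems.Rank2Observatory2DescClSplitImageSoundTwo
import HarnessLib

/-!
# BirchSwinnertonDyer — rank ≥ 2 observatory: KERNEL-2DESC-CL — NODAL LOCAL CONDITIONS AT A 2-ADICALLY SPLIT PRIME (M4a-two)

HONEST FRAMING: per-curve certified theorems and census instruments; no claim on BSD in rank ≥ 2.

The `ℓ = 2` twin of `…SplitImageNodal`: same setting (three ring maps `φ_i : K → ℚ_2`, `φ_i θ = z_i`, `‖z_i − a_i‖ ≤ 2^{−N}`,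
a root `e` of the curve cubic with `m² e = X_t(θ)`, a family `m² w_j = X_j(θ)`, a rational point with `y ≠ 0` and a subset
`U` with `(x − e)∏_{j∈U} w_j ∈ K^{×2}`), classes now in `ℚ_2^×/ℚ_2^{×2}` (three bits `(v mod 2, χ₋₁, χ₂)`, abstract
`S : SqClassMapTwo`).  Kernel checks: `X_t(a_i)` pairwise distinct, `nodeDepth 2 (X_t(a_i)) + 4 ≤ N`, and
`X_j(a_i) ≠ 0`, `v_2(X_j(a_i)) + 3 ≤ N`.  Conclusion: the kernel-computed 9-bit class vector `uvecTwo (X_j(a_i)) U` lies in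
`splitImgTwo (X_t(a_i))` (M3 2-adic tree, sound by `vecTwo_mem_splitImgTwo`).  The generic `ℤ_ℓ` bookkeeping
(`quadZ`, `exists_quadZ_eq_add`, `pow_dvd_sub_of_eq`, `cubic_eq_prod3`, `oddCard`) is imported from the odd file at `ℓ = 2`.

Sorry-free; axioms `propext`, `Classical.choice`, `Quot.sound`.
[cite: Cassels1991LecturesEllipticCurves, §15]
-/

noncomputable section

set_option linter.dupNamespace false
set_option autoImplicit false

open Polynomial NumberField Literature.NumberTheory.NumberFields

namespace Summit.BirchSwinnertonDyer.BirchSwinnertonDyer.Rank2Observatory.TwoDescCl.SplitImage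

/-! ## §1 Kernel functions at `2` (computable) -/

/-- The three class bits of a non-zero integer at `2`: `(v_2 mod 2, χ₋₁, χ₂ of the unit part)`. [folklore] -/
def bitsIntTwo (d : ℤ) : Bool × (Bool × Bool) := (decide (valInt 2 d % 2 = 1), chiBits (unitPart 2 d))

/-- The class of `∏_{j∈U} w_j` at one root, from the integer table `d j = X_j(a)` (`ℓ = 2`). [folklore] -/
def uclsTwo {ι : Type*} (d : ι → ℤ) (U : Finset ι) : Bool × (Bool × Bool) :=
  (oddCard U fun j => (bitsIntTwo (d j)).1,
    (oddCard U fun j => (bitsIntTwo (d j)).2.1, oddCard U fun j => (bitsIntTwo (d j)).2.2))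

/-- **The kernel's 2-adic class vector of a subset `U`** at the three roots (9-bit mask), from the table
`d i j = X_j(a_i)`. [cite: Cassels1991LecturesEllipticCurves, §15] -/
def uvecTwo {ι : Type*} (d : Fin 3 → ι → ℤ) (U : Finset ι) : ℕ :=
  vec3Two (uclsTwo (d 0) U) (uclsTwo (d 1) U) (uclsTwo (d 2) U)

/-! ## §2 Class-map algebra at `2` -/

/-- `cls 1 = 0` (`ℓ = 2`). [folklore] -/
theorem cls_one_two (S : SqClassMapTwo) : S.cls 1 = (false, (false, false)) := by
  have h := S.cls_mul 1 1 one_ne_zero one_ne_zero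
  rw [mul_one] at h
  rw [h]
  simp only [bne_self_eq_false]

/-- A square factor does not change the class (`ℓ = 2`). [folklore] -/
theorem cls_mul_self_mul_two (S : SqClassMapTwo) {u v : ℚ_[2]} (hu : u ≠ 0) (hv : v ≠ 0) :
    S.cls (u * u * v) = S.cls v := by
  rw [S.cls_mul _ _ (mul_ne_zero hu hu) hv, S.cls_mul u u hu hu]
  simp only [bne_self_eq_false]
  generalize S.cls v = c
  obtain ⟨b1, b2, b3⟩ := c
  cases b1 <;> cases b2 <;> cases b3 <;> rfl

/-- If `u·v` is a square (`u, v ≠ 0`) then `cls u = cls v` (`ℓ = 2`). [cite: Cassels1991LecturesEllipticCurves, §15] -/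
theorem cls_eq_of_isSquare_mul_two (S : SqClassMapTwo) {u v : ℚ_[2]} (hu : u ≠ 0) (hv : v ≠ 0)
    (h : IsSquare (u * v)) : S.cls u = S.cls v := by
  obtain ⟨s, hs⟩ := h
  have hs0 : s ≠ 0 := by
    intro h0; rw [h0, mul_zero] at hs; exact mul_ne_zero hu hv hs
  have e1 := S.cls_mul s s hs0 hs0
  rw [← hs, S.cls_mul u v hu hv] at e1
  simp only [bne_self_eq_false, Prod.mk.injEq] at e1
  obtain ⟨e1, e2, e3⟩ := e1
  rcases hcu : S.cls u with ⟨a1, a2, a3⟩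
  rcases hcv : S.cls v with ⟨b1, b2, b3⟩
  rw [hcu, hcv] at e1 e2 e3
  revert e1 e2 e3
  cases a1 <;> cases a2 <;> cases a3 <;> cases b1 <;> cases b2 <;> cases b3 <;> decide

/-- **Class of a product over a subset** = parities of the three class bits (`ℓ = 2`). [folklore] -/
theorem cls_prod_two (S : SqClassMapTwo) {ι : Type*} [DecidableEq ι] (g : ι → ℚ_[2]) (U : Finset ι)
    (hg : ∀ j ∈ U, g j ≠ 0) :
    S.cls (∏ j ∈ U, g j) = (oddCard U (fun j => (S.cls (g j)).1),
      (oddCard U (fun j => (S.cls (g j)).2.1), oddCard U (fun j => (S.cls (g j)).2.2))) := by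
  revert hg
  refine Finset.induction_on U (fun _ => ?_) (@fun i U hi ih => ?_)
  · rw [Finset.prod_empty, cls_one_two, oddCard_empty, oddCard_empty, oddCard_empty]
  · intro hg
    have hgi : g i ≠ 0 := hg i (Finset.mem_insert_self i U)
    have hgU : ∀ j ∈ U, g j ≠ 0 := fun j hj => hg j (Finset.mem_insert_of_mem hj)
    have hprod : ∏ j ∈ U, g j ≠ 0 := Finset.prod_ne_zero_iff.mpr hgU
    rw [Finset.prod_insert hi, S.cls_mul _ _ hgi hprod, ih hgU, oddCard_insert hi, oddCard_insert hi,
      oddCard_insert hi]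

/-! ## §3 The per-point nodal lemma at `2` -/

section Padic

variable {K : Type*} [Field K] [NumberField K] {a b c : ℤ} {θ : K}

/-- **NODAL LOCAL CONDITION AT A 2-ADICALLY SPLIT PRIME.**  With three embeddings `φ_i : K → ℚ_2`,
`φ_i θ = z_i`, `‖z_i − a_i‖ ≤ 2^{−N}`, a root `e ∈ 𝓞 K` of the curve cubic with `m²e = X_t(θ)`, a family
`m² w_j = X_j(θ)` of non-zero `w_j`, a rational point `(x, y)`, `y ≠ 0`, and a subset `U` with
`(x − e)∏_{j∈U} w_j` a square in `K`: if the kernel checks pass (`X_t(a_i)` pairwise distinct,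
`nodeDepth 2 (X_t(a_i)) + 4 ≤ N`, every `X_j(a_i) ≠ 0` with `v_2(X_j(a_i)) + 3 ≤ N`), then the kernel's 9-bit
class vector `uvecTwo (X_j(a_i)) U` lies in `splitImgTwo (X_t(a_i))`.
[cite: Cassels1991LecturesEllipticCurves, §15] -/
theorem uvecTwo_mem_splitImgTwo (S : SqClassMapTwo)
    (hθ : aeval θ (MonicCubic.poly a b c) = 0)
    {z : Fin 3 → ℤ_[2]} {φ : Fin 3 → (K →+* ℚ_[2])} (hφ : ∀ i, φ i θ = (z i : ℚ_[2]))
    {ar : Fin 3 → ℤ} {N : ℕ} (hclose : ∀ i, ‖z i - (ar i : ℤ_[2])‖ ≤ ((2 : ℕ) : ℝ) ^ (-(N : ℤ)))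
    {A B C : ℤ} {m : ℤ} (hm : m ≠ 0) {e : 𝓞 K} {Xt : ℤ × ℤ × ℤ}
    (he : ((m ^ 2 : ℤ) : 𝓞 K) * e = TwoDescCubic.lin hθ Xt.1 Xt.2.1 Xt.2.2)
    (hroot : e ^ 3 + (A : 𝓞 K) * e ^ 2 + (B : 𝓞 K) * e + (C : 𝓞 K) = 0)
    {ι : Type*} [DecidableEq ι] {w : ι → 𝓞 K} {X : ι → ℤ × ℤ × ℤ}
    (hw : ∀ j, ((m ^ 2 : ℤ) : 𝓞 K) * w j = TwoDescCubic.lin hθ (X j).1 (X j).2.1 (X j).2.2)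
    (hw0 : ∀ j, w j ≠ 0)
    {x y : ℚ} (hxy : y ^ 2 = x ^ 3 + A * x ^ 2 + B * x + C) (hy : y ≠ 0)
    {U : Finset ι}
    (hsq : IsSquare ((algebraMap ℚ K x - algebraMap (𝓞 K) K e) * ∏ j ∈ U, algebraMap (𝓞 K) K (w j)))
    (hdist : ∀ i k : Fin 3, i ≠ k → evalInt (ar i) Xt ≠ evalInt (ar k) Xt)
    (hdepth : nodeDepth 2 (fun i => evalInt (ar i) Xt) + 4 ≤ N)
    (hprec : ∀ i j, evalInt (ar i) (X j) ≠ 0 ∧ valInt 2 (evalInt (ar i) (X j)) + 3 ≤ N) :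
    uvecTwo (fun i j => evalInt (ar i) (X j)) U ∈ splitImgTwo (fun i => evalInt (ar i) Xt) := by
  have hmQ : (m : ℚ_[2]) ≠ 0 := Int.cast_ne_zero.mpr hm
  have hyQ : (y : ℚ_[2]) ≠ 0 := Rat.cast_ne_zero.mpr hy
  -- the scaled roots `m² φ_i(e) = X_t(z_i)` and family values `m² φ_i(w_j) = X_j(z_i)`
  have hQt : ∀ i, ((m ^ 2 : ℤ) : ℚ_[2]) * φ i (algebraMap (𝓞 K) K e) = (quadZ Xt (z i) : ℚ_[2]) :=
    fun i => mul_emb_eq_quadZ hθ (φ i) (hφ i) he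
  have hQX : ∀ i j, ((m ^ 2 : ℤ) : ℚ_[2]) * φ i (algebraMap (𝓞 K) K (w j)) = (quadZ (X j) (z i) : ℚ_[2]) :=
    fun i j => mul_emb_eq_quadZ hθ (φ i) (hφ i) (hw j)
  have hTt : ∀ i, ∃ T : ℤ_[2], quadZ Xt (z i) = (evalInt (ar i) Xt : ℤ_[2]) + ((2 : ℕ) : ℤ_[2]) ^ N * T :=
    fun i => exists_quadZ_eq_add (hclose i) Xt
  -- the three `φ_i(e)` are roots of `F` in `ℚ_2`, pairwise distinct
  have hrootQ : ∀ i, (φ i (algebraMap (𝓞 K) K e)) ^ 3 + (A : ℚ_[2]) * (φ i (algebraMap (𝓞 K) K e)) ^ 2 +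
      (B : ℚ_[2]) * φ i (algebraMap (𝓞 K) K e) + (C : ℚ_[2]) = 0 := by
    intro i
    have h := congrArg (fun t : 𝓞 K => φ i (algebraMap (𝓞 K) K t)) hroot
    simp only [map_add, map_mul, map_pow, map_intCast, map_zero] at h
    exact h
  have hinj : ∀ i k : Fin 3, i ≠ k → φ i (algebraMap (𝓞 K) K e) ≠ φ k (algebraMap (𝓞 K) K e) := by
    intro i k hik heq
    obtain ⟨Ti, hTi⟩ := hTt i
    obtain ⟨Tk, hTk⟩ := hTt k
    have hq : quadZ Xt (z i) = quadZ Xt (z k) := by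
      apply Subtype.ext
      show (quadZ Xt (z i) : ℚ_[2]) = (quadZ Xt (z k) : ℚ_[2])
      rw [← hQt i, ← hQt k, heq]
    rw [hTi, hTk] at hq
    rcases (pow_dvd_iff_valInt N _).mp (pow_dvd_sub_of_eq hq) with h0 | hle
    · exact hdist i k hik (sub_eq_zero.mp h0)
    · have h1 := valInt_sub_le_nodeDepth (ℓ := 2) (fun i => evalInt (ar i) Xt) i k hik
      omega
  have hF := cubic_eq_prod3 (hrootQ 0) (hrootQ 1) (hrootQ 2) (hinj 0 1 (by decide)) (hinj 0 2 (by decide))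
    (hinj 1 2 (by decide))
  -- the curve equation in `ℚ_2`, factored, and its scaled form
  have hxyQ : ((y : ℚ_[2])) ^ 2 = (x : ℚ_[2]) ^ 3 + (A : ℚ_[2]) * (x : ℚ_[2]) ^ 2 + (B : ℚ_[2]) * (x : ℚ_[2]) +
      (C : ℚ_[2]) := by
    have h := congrArg (Rat.cast : ℚ → ℚ_[2]) hxy
    push_cast at h
    exact h
  have hc : ((y : ℚ_[2])) ^ 2 = ((x : ℚ_[2]) - φ 0 (algebraMap (𝓞 K) K e)) *
      ((x : ℚ_[2]) - φ 1 (algebraMap (𝓞 K) K e)) * ((x : ℚ_[2]) - φ 2 (algebraMap (𝓞 K) K e)) :=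
    hxyQ.trans (hF _)
  obtain ⟨hx0, hx1, hx2⟩ := ne_zero_of_sq hyQ hc
  have hxe : ∀ i : Fin 3, (x : ℚ_[2]) - φ i (algebraMap (𝓞 K) K e) ≠ 0 := by
    intro i; fin_cases i
    exacts [hx0, hx1, hx2]
  have hy' : ((m ^ 3 : ℤ) : ℚ_[2]) * (y : ℚ_[2]) ≠ 0 :=
    mul_ne_zero (Int.cast_ne_zero.mpr (pow_ne_zero 3 hm)) hyQ
  have hcurve' : (((m ^ 3 : ℤ) : ℚ_[2]) * (y : ℚ_[2])) ^ 2 =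
      (((m ^ 2 : ℤ) : ℚ_[2]) * (x : ℚ_[2]) - (quadZ Xt (z 0) : ℚ_[2])) *
      (((m ^ 2 : ℤ) : ℚ_[2]) * (x : ℚ_[2]) - (quadZ Xt (z 1) : ℚ_[2])) *
      (((m ^ 2 : ℤ) : ℚ_[2]) * (x : ℚ_[2]) - (quadZ Xt (z 2) : ℚ_[2])) := by
    rw [← hQt 0, ← hQt 1, ← hQt 2]
    push_cast
    linear_combination (m : ℚ_[2]) ^ 6 * hc
  -- the approximations at tree precision `2^(D+4)`
  have happ' : ∀ i, ∃ t : ℤ_[2], quadZ Xt (z i) =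
      (evalInt (ar i) Xt : ℤ_[2]) + (2 : ℤ_[2]) ^ (nodeDepth 2 (fun i => evalInt (ar i) Xt) + 4) * t := by
    intro i
    obtain ⟨T, hT⟩ := hTt i
    obtain ⟨d, hd⟩ := Nat.exists_eq_add_of_le hdepth
    refine ⟨(2 : ℤ_[2]) ^ d * T, ?_⟩
    rw [hT, hd, pow_add, Nat.cast_ofNat]
    ring
  -- M3 (2-adic tree soundness) on the scaled point
  have hmem := vecTwo_mem_splitImgTwo S (e := fun i => quadZ Xt (z i)) (ē := fun i => evalInt (ar i) Xt)
    hdist happ' hy' hcurve'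
  -- identify the class vector with the kernel's
  have hcls_pt : ∀ i, S.cls (((m ^ 2 : ℤ) : ℚ_[2]) * (x : ℚ_[2]) - (quadZ Xt (z i) : ℚ_[2])) =
      S.cls ((x : ℚ_[2]) - φ i (algebraMap (𝓞 K) K e)) := by
    intro i
    have h1 : ((m ^ 2 : ℤ) : ℚ_[2]) * (x : ℚ_[2]) - (quadZ Xt (z i) : ℚ_[2]) =
        (m : ℚ_[2]) * (m : ℚ_[2]) * ((x : ℚ_[2]) - φ i (algebraMap (𝓞 K) K e)) := by
      rw [← hQt i]; push_cast; ring
    rw [h1, cls_mul_self_mul_two S hmQ (hxe i)]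
  have hwK0 : ∀ i j, φ i (algebraMap (𝓞 K) K (w j)) ≠ 0 :=
    fun i j => (map_ne_zero (φ i)).mpr (RingOfIntegers.coe_ne_zero_iff.mpr (hw0 j))
  have hcls_w : ∀ i j, S.cls (φ i (algebraMap (𝓞 K) K (w j))) = bitsIntTwo (evalInt (ar i) (X j)) := by
    intro i j
    obtain ⟨T, hT⟩ := exists_quadZ_eq_add (hclose i) (X j)
    have h1 : S.cls (((m ^ 2 : ℤ) : ℚ_[2]) * φ i (algebraMap (𝓞 K) K (w j))) = bitsIntTwo (evalInt (ar i) (X j)) := by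
      unfold bitsIntTwo
      apply cls_eq_of_approx_two S T (hprec i j).1 (hprec i j).2
      rw [hQX i j, hT]
      push_cast [PadicInt.coe_natCast, Nat.cast_ofNat, coe_two]
      ring
    have h2 : ((m ^ 2 : ℤ) : ℚ_[2]) * φ i (algebraMap (𝓞 K) K (w j)) =
        (m : ℚ_[2]) * (m : ℚ_[2]) * φ i (algebraMap (𝓞 K) K (w j)) := by
      push_cast; ring
    rw [h2, cls_mul_self_mul_two S hmQ (hwK0 i j)] at h1
    exact h1
  have hxK : ∀ i, φ i (algebraMap ℚ K x) = (x : ℚ_[2]) := fun i => by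
    rw [eq_ratCast (algebraMap ℚ K) x, map_ratCast]
  have hclsU : ∀ i, S.cls ((x : ℚ_[2]) - φ i (algebraMap (𝓞 K) K e)) =
      uclsTwo (fun j => evalInt (ar i) (X j)) U := by
    intro i
    have hsqi := hsq.map (φ i)
    rw [map_mul, map_sub, hxK i, map_prod] at hsqi
    have hprod0 : ∏ j ∈ U, φ i (algebraMap (𝓞 K) K (w j)) ≠ 0 :=
      Finset.prod_ne_zero_iff.mpr fun j _ => hwK0 i j
    rw [cls_eq_of_isSquare_mul_two S (hxe i) hprod0 hsqi, cls_prod_two S _ U (fun j _ => hwK0 i j)]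
    have hf1 : (fun j => (S.cls (φ i (algebraMap (𝓞 K) K (w j)))).1) =
        fun j => (bitsIntTwo (evalInt (ar i) (X j))).1 := funext fun j => by rw [hcls_w i j]
    have hf2 : (fun j => (S.cls (φ i (algebraMap (𝓞 K) K (w j)))).2.1) =
        fun j => (bitsIntTwo (evalInt (ar i) (X j))).2.1 := funext fun j => by rw [hcls_w i j]
    have hf3 : (fun j => (S.cls (φ i (algebraMap (𝓞 K) K (w j)))).2.2) =
        fun j => (bitsIntTwo (evalInt (ar i) (X j))).2.2 := funext fun j => by rw [hcls_w i j]
    rw [hf1, hf2, hf3]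
    rfl
  have hvec : vecTwo S (((m ^ 2 : ℤ) : ℚ_[2]) * (x : ℚ_[2])) (fun i => quadZ Xt (z i)) =
      uvecTwo (fun i j => evalInt (ar i) (X j)) U := by
    unfold vecTwo uvecTwo
    simp only [hcls_pt, hclsU]
  rw [← hvec]
  exact hmem

end Padic

end Summit.BirchSwinnertonDyer.BirchSwinnertonDyer.Rank2Observatory.TwoDescCl.SplitImage

end
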